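import Mathlib.RepresentationTheory.Coinvariants
import Mathlib.LinearAlgebra.Basis.VectorSpace
import Literature.NumberTheory.Automorphic.WhittakerModels
import HarnessLib

/-!
# Twisted coinvariant kernels `V(S, θ) = ⟨ρ(g) v - θ(g) v⟩` and Whittaker functionals

For a representation `ρ` of a group `G` on a `k`-module `V`, a set `S ⊆ G` and a function
`θ : G → k`, the **twisted coinvariant kernel** (twisted augmentation submodule)
`V(S, θ) = Representation.twistedSpan ρ S θ` is the submodule spanned by the vectors
`ρ(g) v - θ(g) v`, `g ∈ S`, `v ∈ V`. When `S = N` is a subgroup and `θ` a character of `N`, the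
quotient `V / V(N, θ)` is the space of `(N, θ)`-coinvariants — the *twisted Jacquet module*
`J_{N,θ}(V)` (Bump 1997, §4.4, p. 462: "`V_{N,ψ}` … generated by elements of the form
`π(u) v - ψ_N(u) v` … and `J_ψ(V) = V / V_{N,ψ}`"; Bernstein–Zelevinsky 1976, §2.30–2.35), and the
linear forms on `V` vanishing on `V(N, θ)` are exactly the `(N, θ)`-quasi-invariant functionals;
for `N = U_n` and the generic character this is the space of Whittaker functionals (Bump 1997,
proof of Prop. 4.4.4: "a linear functional on `V` is a Whittaker functional if and only if it
annihilates `V_{N,ψ}`").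

This file is the submodule calculus of these kernels used in the proof that supercuspidal
representations of `GL_n(F)` are generic (`WhittakerModelsSupercuspidalProofs`):

* `Representation.twistedSpan` and its generators, monotonicity in `S`, dependence on `θ|_S`
  only, unions, the parametrised form for `S = range s` (`twistedSpan_range`), transport by
  `ρ g` (`map_twistedSpan_family`: `ρ(g) V(s, c) = V(g s g⁻¹, c)`), and stability under
  elements normalising `(S, θ)` (`apply_mem_twistedSpan_of_conj`);
* the **product formula** `twistedSpan_eq_sup_of_mul`: if `H = S · T` with `T` normalised by `S`
  and `θ` multiplicative across the product and `S`-conjugation invariant on `T`, then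
  `V(H, θ) = V(S, θ) + V(T, θ)` (transitivity of coinvariants, Bernstein–Zelevinsky 1976, §2.32);
* the untwisted case: `Representation.Coinvariants.ker (ρ.comp φ) = V(range φ, 1)`
  (`coinvariantsKer_comp_eq_twistedSpan`), in particular for the Jacquet kernels of `GL_n`
  (`coinvariantsKer_restrictUnipotentGL_eq_twistedSpan`);
* Whittaker functionals: `Λ` is a `ψ`-Whittaker functional iff `Λ` kills `V(U_n, ψ_U)`
  (`mem_whittakerFunctionals_iff_twistedSpan_le_ker`), hence `π` is generic as soon as
  `V(U_n, ψ_U) ≠ V` (`isGeneric_of_twistedSpan_ne_top`, Bump 1997, Prop. 4.4.4 (proof)).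

All statements are proved; the only definition is `Representation.twistedSpan` (a deliberate
dot-notation extension of Mathlib's `Representation` namespace, like `Representation.matrixCoeff`
of `MatrixCoefficients`); no named facts, no instances, no `sorry`.

## References

* D. Bump, *Automorphic Forms and Representations* (1997), §4.4, pp. 460–462 of the held copy
  (`V_N`, `V_{N,ψ}`, `J_ψ`, Prop. 4.4.4). [Bump1997]
* I. N. Bernstein, A. V. Zelevinsky, Russian Math. Surveys 31:3 (1976), §2.30–2.35.
  [BernsteinZelevinsky1976]
-/

open scoped Pointwise

/-! ### The twisted coinvariant kernel -/

namespace Representation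

section CommRing

variable {k G V : Type*} [CommRing k] [Group G] [AddCommGroup V] [Module k V]
  (ρ : Representation k G V)

/-- The **twisted coinvariant kernel** `V(S, θ) = ⟨ρ(g) v - θ(g) • v : g ∈ S, v ∈ V⟩` of a
representation `ρ`, for a set `S ⊆ G` and a function `θ : G → k` (in applications `S` is a
subgroup, or a parametrised family generating one, and `θ` a character on it). For `θ = 1` and
`S = G` this is Mathlib's `Representation.Coinvariants.ker`. (Bump 1997, §4.4, p. 462, `V_{N,ψ}`;
Bernstein–Zelevinsky 1976, §2.30, `V(H, θ)`.) A deliberate dot-notation extension of Mathlib's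
`Representation` namespace. [cite: Bump1997, §4.4 (PDF p. 462), definition of V_{N,ψ}] -/
def twistedSpan (S : Set G) (θ : G → k) : Submodule k V :=
  Submodule.span k {w | ∃ g ∈ S, ∃ v, w = ρ g v - θ g • v}

variable {ρ}

/-- The generators `ρ(g) v - θ(g) • v`, `g ∈ S`, lie in `V(S, θ)`. [folklore] -/
theorem sub_smul_mem_twistedSpan {S : Set G} (θ : G → k) {g : G} (hg : g ∈ S) (v : V) :
    ρ g v - θ g • v ∈ ρ.twistedSpan S θ :=
  Submodule.subset_span ⟨g, hg, v, rfl⟩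

/-- `V(S, θ)` is monotone in `S`. [folklore] -/
theorem twistedSpan_mono {S S' : Set G} (h : S ⊆ S') (θ : G → k) :
    ρ.twistedSpan S θ ≤ ρ.twistedSpan S' θ :=
  Submodule.span_mono fun _ ⟨g, hg, v, hw⟩ => ⟨g, h hg, v, hw⟩

/-- `V(S, θ)` only depends on `θ|_S`. [folklore] -/
theorem twistedSpan_congr {S : Set G} {θ θ' : G → k} (h : ∀ g ∈ S, θ g = θ' g) :
    ρ.twistedSpan S θ = ρ.twistedSpan S θ' := by
  unfold twistedSpan
  congr 1
  ext w
  constructor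
  · rintro ⟨g, hg, v, rfl⟩; exact ⟨g, hg, v, by rw [h g hg]⟩
  · rintro ⟨g, hg, v, rfl⟩; exact ⟨g, hg, v, by rw [h g hg]⟩

/-- `V(S ∪ S', θ) = V(S, θ) + V(S', θ)`. [folklore] -/
theorem twistedSpan_union (S S' : Set G) (θ : G → k) :
    ρ.twistedSpan (S ∪ S') θ = ρ.twistedSpan S θ ⊔ ρ.twistedSpan S' θ := by
  unfold twistedSpan
  rw [← Submodule.span_union]
  congr 1
  ext w
  simp only [Set.mem_union, Set.mem_setOf_eq]
  constructor
  · rintro ⟨g, hg | hg, v, hw⟩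
    · exact Or.inl ⟨g, hg, v, hw⟩
    · exact Or.inr ⟨g, hg, v, hw⟩
  · rintro (⟨g, hg, v, hw⟩ | ⟨g, hg, v, hw⟩)
    · exact ⟨g, Or.inl hg, v, hw⟩
    · exact ⟨g, Or.inr hg, v, hw⟩

/-- **Parametrised form.** For a family `s : ι → G` and `θ`,
`V(range s, θ) = ⟨ρ(s i) v - θ(s i) • v⟩`. [folklore] -/
theorem twistedSpan_range {ι : Type*} (s : ι → G) (θ : G → k) :
    ρ.twistedSpan (Set.range s) θ =
      Submodule.span k {w | ∃ (i : ι) (v : V), w = ρ (s i) v - θ (s i) • v} := by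
  unfold twistedSpan
  congr 1
  ext w
  constructor
  · rintro ⟨g, ⟨i, rfl⟩, v, rfl⟩; exact ⟨i, v, rfl⟩
  · rintro ⟨i, v, rfl⟩; exact ⟨s i, ⟨i, rfl⟩, v, rfl⟩

/-- **Transport by `ρ g`** (parametrised form): `ρ(g)` maps `⟨ρ(s i) v - c i • v⟩` onto
`⟨ρ(g s i g⁻¹) v - c i • v⟩` (`π(t)(π(u) v - v) = π(u') v' - v'`, `u' = t u t⁻¹`, `v' = π(t) v`:
Bump 1997, §4.4, p. 460). [cite: Bump1997, §4.4 (PDF p. 460)] -/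
theorem map_twistedSpan_family {ι : Type*} (s : ι → G) (c : ι → k) (g : G) :
    (Submodule.span k {w | ∃ (i : ι) (v : V), w = ρ (s i) v - c i • v}).map (ρ g) =
      Submodule.span k {w | ∃ (i : ι) (v : V), w = ρ (g * s i * g⁻¹) v - c i • v} := by
  refine le_antisymm ?_ ?_
  · rw [Submodule.map_span_le]
    rintro w ⟨i, v, rfl⟩
    refine Submodule.subset_span ⟨i, ρ g v, ?_⟩
    rw [map_sub, map_smul, ← Module.End.mul_apply, ← map_mul, ← Module.End.mul_apply,
      ← map_mul, inv_mul_cancel_right]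
  · rw [Submodule.span_le]
    rintro w ⟨i, v, rfl⟩
    refine ⟨ρ (s i) (ρ g⁻¹ v) - c i • ρ g⁻¹ v, Submodule.subset_span ⟨i, ρ g⁻¹ v, rfl⟩, ?_⟩
    rw [map_sub, map_smul, ← Module.End.mul_apply, ← map_mul, ← Module.End.mul_apply,
      ← map_mul, ← Module.End.mul_apply, ← map_mul, mul_inv_cancel, map_one, Module.End.one_apply,
      mul_assoc]

/-- **Stability under normalising elements.** If `g` conjugates `S` into `S` preserving `θ`
(`g s g⁻¹ ∈ S` and `θ (g s g⁻¹) = θ s` for `s ∈ S`), then `ρ g` preserves `V(S, θ)`. [folklore] -/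
theorem apply_mem_twistedSpan_of_conj {S : Set G} {θ : G → k} {g : G}
    (hS : ∀ s ∈ S, g * s * g⁻¹ ∈ S) (hθ : ∀ s ∈ S, θ (g * s * g⁻¹) = θ s) {w : V}
    (hw : w ∈ ρ.twistedSpan S θ) : ρ g w ∈ ρ.twistedSpan S θ := by
  induction hw using Submodule.span_induction with
  | mem w hw =>
    obtain ⟨s, hs, v, rfl⟩ := hw
    have : ρ g (ρ s v - θ s • v) = ρ (g * s * g⁻¹) (ρ g v) - θ (g * s * g⁻¹) • ρ g v := by
      rw [map_sub, map_smul, hθ s hs, ← Module.End.mul_apply, ← map_mul, ← Module.End.mul_apply,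
        ← map_mul, inv_mul_cancel_right]
    rw [this]
    exact sub_smul_mem_twistedSpan θ (hS s hs) _
  | zero => rw [map_zero]; exact Submodule.zero_mem _
  | add x y _ _ hx hy => rw [map_add]; exact Submodule.add_mem _ hx hy
  | smul a x _ hx => rw [map_smul]; exact Submodule.smul_mem _ a hx

/-- **Product formula** (transitivity of twisted coinvariants). Let `S, T ⊆ H ⊆ G` with
`H = S · T`, `T` stable under conjugation by `S`, and `θ : G → k` multiplicative across the
product (`θ (s t) = θ s θ t`) and `S`-conjugation invariant on `T`. Then
`V(H, θ) = V(S, θ) + V(T, θ)`: indeed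
`ρ(s t) v - θ(s t) v = (ρ(s t s⁻¹) w - θ(t) w) + θ(t) (ρ(s) v - θ(s) v)` with `w = ρ(s) v`.
(Bernstein–Zelevinsky 1976, §2.32, `(V_{N₁,θ₁})_{N₂,θ₂}`; Bump 1997, §4.4.) [folklore] -/
theorem twistedSpan_eq_sup_of_mul {H S T : Set G} {θ : G → k} (hS : S ⊆ H) (hT : T ⊆ H)
    (hST : ∀ h ∈ H, ∃ s ∈ S, ∃ t ∈ T, h = s * t) (hconj : ∀ s ∈ S, ∀ t ∈ T, s * t * s⁻¹ ∈ T)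
    (hθmul : ∀ s ∈ S, ∀ t ∈ T, θ (s * t) = θ s * θ t)
    (hθconj : ∀ s ∈ S, ∀ t ∈ T, θ (s * t * s⁻¹) = θ t) :
    ρ.twistedSpan H θ = ρ.twistedSpan S θ ⊔ ρ.twistedSpan T θ := by
  refine le_antisymm ?_ (sup_le (twistedSpan_mono hS θ) (twistedSpan_mono hT θ))
  rw [twistedSpan, Submodule.span_le]
  rintro w ⟨h, hh, v, rfl⟩
  obtain ⟨s, hs, t, ht, rfl⟩ := hST h hh
  have key : ρ (s * t) v - θ (s * t) • v =
      (ρ (s * t * s⁻¹) (ρ s v) - θ (s * t * s⁻¹) • ρ s v) + θ t • (ρ s v - θ s • v) := by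
    rw [hθconj s hs t ht, hθmul s hs t ht, smul_sub, smul_smul, mul_comm (θ t) (θ s),
      ← Module.End.mul_apply, ← map_mul, inv_mul_cancel_right]
    abel
  rw [key]
  exact Submodule.add_mem _ (Submodule.mem_sup_right (sub_smul_mem_twistedSpan θ (hconj s hs t ht) _))
    (Submodule.mem_sup_left (Submodule.smul_mem _ _ (sub_smul_mem_twistedSpan θ hs v)))

/-- A subspace containing `V(S, 1)` is stable under `ρ s`, `s ∈ S`:
`ρ s w = (ρ s w - w) + w`. [folklore] -/
theorem apply_mem_of_twistedSpan_one_le {S : Set G} {W : Submodule k V}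
    (hW : ρ.twistedSpan S 1 ≤ W) {s : G} (hs : s ∈ S) {w : V} (hw : w ∈ W) : ρ s w ∈ W := by
  have h := hW (sub_smul_mem_twistedSpan (1 : G → k) hs w)
  rw [Pi.one_apply, one_smul] at h
  simpa using W.add_mem h hw

/-- More generally, a subspace containing `V(S, θ)` is stable under `ρ s`, `s ∈ S`:
`ρ s w = (ρ s w - θ s • w) + θ s • w`. [folklore] -/
theorem apply_mem_of_twistedSpan_le {S : Set G} {θ : G → k} {W : Submodule k V}
    (hW : ρ.twistedSpan S θ ≤ W) {s : G} (hs : s ∈ S) {w : V} (hw : w ∈ W) : ρ s w ∈ W := by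
  have h := hW (sub_smul_mem_twistedSpan θ hs w)
  simpa using W.add_mem h (W.smul_mem (θ s) hw)

/-- **The untwisted case is Mathlib's coinvariant kernel**: for a homomorphism `φ : H →* G`,
`Coinvariants.ker (ρ ∘ φ) = V(range φ, 1)`. [folklore] -/
theorem coinvariantsKer_comp_eq_twistedSpan {H : Type*} [Group H] (φ : H →* G) :
    Coinvariants.ker (ρ.comp φ) = ρ.twistedSpan (Set.range φ) 1 := by
  unfold Coinvariants.ker twistedSpan
  congr 1
  ext w
  simp only [Set.mem_range, Set.mem_setOf_eq, Pi.one_apply, one_smul]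
  constructor
  · rintro ⟨⟨h, v⟩, rfl⟩
    exact ⟨φ h, ⟨h, rfl⟩, v, rfl⟩
  · rintro ⟨g, ⟨h, rfl⟩, v, rfl⟩
    exact ⟨⟨h, v⟩, rfl⟩

end CommRing

end Representation

/-! ### Jacquet kernels of `GL_n` and Whittaker functionals -/

namespace Literature.NumberTheory.Automorphic

open Representation

section Jacquet

variable {k : Type*} [CommRing k] {R : Type*} [CommRing R] {n : Type*} [Fintype n]
  [DecidableEq n] {α : Type*} [LinearOrder α] (c : n → α)
  {V : Type*} [AddCommGroup V] [Module k V] (π : Representation k (GL n R) V)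

/-- **The Jacquet kernel of `GL_n` as a twisted span**: the kernel `V(U_c)` of the Jacquet
module `V → V_{U_c}` (coinvariants of `Representation.restrictUnipotentGL R c π`) is
`V(U_c, 1) = ⟨π(u) v - v : u ∈ U_c⟩`. (Bernstein–Zelevinsky 1977, §1.8; Bump 1997, §4.4, p. 460,
`V_N`.) [folklore] -/
theorem coinvariantsKer_restrictUnipotentGL_eq_twistedSpan :
    Coinvariants.ker (restrictUnipotentGL R c π) =
      π.twistedSpan (unipotentRadicalGL R c : Set (GL n R)) 1 := by
  have h : restrictUnipotentGL R c π =
      π.comp ((standardParabolicGL R c).subtype.comp (unipotentRadicalP R c).subtype) := rfl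
  rw [h, coinvariantsKer_comp_eq_twistedSpan]
  congr 1
  ext g
  simp only [Set.mem_range, MonoidHom.coe_comp, Subgroup.coe_subtype, Function.comp_apply,
    SetLike.mem_coe, unipotentRadicalGL, Subgroup.mem_map]
  constructor
  · rintro ⟨p, rfl⟩
    exact ⟨p, p.2, rfl⟩
  · rintro ⟨p, hp, rfl⟩
    exact ⟨⟨p, hp⟩, rfl⟩

end Jacquet

section Whittaker

variable {R : Type*} [CommRing R] {n : ℕ} {V : Type*} [AddCommGroup V] [Module ℂ V]
  (π : Representation ℂ (GL (Fin n) R) V) (ψ : AddChar R Circle)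

/-- **Whittaker functionals are the linear forms killing `V(U_n, ψ_U)`** (Bump 1997, proof of
Prop. 4.4.4: "a linear functional on `V` is a Whittaker functional if and only if it
annihilates `V_{N,ψ}`"): for any `θ : GL_n(R) → ℂ` agreeing with the generic character `ψ_U`
on `U_n`, `Λ ∈ whittakerFunctionals π ψ ↔ V(U_n, θ) ≤ ker Λ`.
[cite: Bump1997, Proposition 4.4.4 (proof) (PDF p. 462)] -/
theorem mem_whittakerFunctionals_iff_twistedSpan_le_ker {θ : GL (Fin n) R → ℂ}
    (hθ : ∀ u : ↥(upperUnitriangular (Fin n) R), θ u = whittakerCharFun ψ u)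
    (Λ : Module.Dual ℂ V) :
    Λ ∈ whittakerFunctionals π ψ ↔
      π.twistedSpan (upperUnitriangular (Fin n) R : Set (GL (Fin n) R)) θ ≤ LinearMap.ker Λ := by
  rw [mem_whittakerFunctionals_iff, Representation.twistedSpan, Submodule.span_le]
  constructor
  · rintro h w ⟨g, hg, v, rfl⟩
    rw [SetLike.mem_coe, LinearMap.mem_ker, map_sub, map_smul, h ⟨g, hg⟩ v, ← hθ ⟨g, hg⟩,
      smul_eq_mul, sub_self]
  · intro h u v
    have := h ⟨(u : GL (Fin n) R), u.2, v, rfl⟩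
    rw [SetLike.mem_coe, LinearMap.mem_ker, map_sub, map_smul, sub_eq_zero, smul_eq_mul] at this
    rw [this, hθ u]

/-- **Genericity from the non-vanishing of the twisted Jacquet module**: if
`V(U_n, ψ_U) ≠ V` then `π` admits a non-zero `ψ`-Whittaker functional — any non-zero linear form
on `V` vanishing on the proper subspace `V(U_n, ψ_U)` (which exists since `ℂ` is a field:
`Submodule.exists_le_ker_of_lt_top`). (Bump 1997, Prop. 4.4.4 (proof): Whittaker functionals are
the dual of `J_ψ(V) = V / V_{N,ψ}`.) [cite: Bump1997, Proposition 4.4.4 (proof) (PDF p. 462)] -/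
theorem isGeneric_of_twistedSpan_ne_top {θ : GL (Fin n) R → ℂ}
    (hθ : ∀ u : ↥(upperUnitriangular (Fin n) R), θ u = whittakerCharFun ψ u)
    (h : π.twistedSpan (upperUnitriangular (Fin n) R : Set (GL (Fin n) R)) θ ≠ ⊤) :
    IsGeneric π ψ := by
  obtain ⟨Λ, hΛ0, hΛ⟩ := Submodule.exists_le_ker_of_lt_top _ (lt_top_iff_ne_top.2 h)
  exact (isGeneric_iff π ψ).2
    ⟨Λ, (mem_whittakerFunctionals_iff_twistedSpan_le_ker π ψ hθ Λ).2 hΛ, hΛ0⟩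

end Whittaker

end Literature.NumberTheory.Automorphic
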